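import Summits.HodgeConjecture.HodgeConjecture.Theorems.LinearSystemTorelliLocalTubeSpanNCNodal
import Summits.HodgeConjecture.HodgeConjecture.Theorems.LinearSystemTorelliLocalTubeSpanReduction

/-!
# Route LinearSystemTorelli — crux `LocalTubeSpan`: relations carried by an orthogonal sub-configuration

Helper file (`--supports stmt-HodgeConjecture-2490`, line `Sketch`, cycle 4 wave 3, stub
`stub_ncSubconfiguration`).  The crux ("local Schnell theorem", C. Schnell, *Primitive cohomology
and the tube mapping*, Math. Z. 268 (2010) §3, §7) is reduced by the line to CYCLIC DETECTION —
injectivity of Schnell's third map `evalCoinv A : H¹(G, V) → ∏_{g ∈ G} V/(g - 1)V` — for a group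
`G` generated by a set `s` of meridians acting on the finite-dimensional vanishing cohomology
`V = A` through Picard–Lefschetz transvections `x ↦ x - B(x, e_t) e_t` (`t ∈ s`) of a
nondegenerate form `B`.  This file packages two landed, unconditional theorems of the tree into
the unconditional case "every linear relation among the generator cycles `e_t` is supported on a
pairwise `B`-ORTHOGONAL finite sub-family `s' ⊆ s`" (transversal nodes; e.g. a tacnode + node
member with the relation `δ₁ + δ₃ + δ₄ = 0` among pairwise orthogonal cycles):

* `localTubeSpan_injective_evalCoinv_of_ncSubconfiguration` — if `s' ⊆ s` is finite, the cycles
  `e_t`, `t ∈ s'`, are non-zero and pairwise `B`-orthogonal, and the remaining cycles `e_t`,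
  `t ∈ s ∖ s'`, are linearly independent modulo `span {e_t : t ∈ s'}`, then Schnell's third map of
  `G` is injective.

Proof: the normal-crossing nodal lemma
(`localTubeSpan_injective_evalCoinv_of_orthogonal_transvections`, rank-drop detection) applied to
the restriction of `A` to `⟨s'⟩`, whose generators `t ∈ s'` (enumerated by `Fin n`) act as
commuting transvections along the orthogonal non-zero cycles `e_t`, gives injectivity of the third
map of `⟨s'⟩`; the sub-configuration reduction
(`localTubeSpan_injective_evalCoinv_of_subconfiguration`: coboundary adjustment on `⟨s'⟩`, then
`B`-duality on the independent directions) lifts it to `G`.  No named fact is used.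

References: [Schnell2010] C. Schnell, Primitive cohomology and the tube mapping, Math. Z. 268
(2010) §7 Prop. 12.
-/

-- `Summit.HodgeConjecture.HodgeConjecture.Theorems` is the mandated namespace (single-conjunct summit:
-- Sub = Summit), which `linter.dupNamespace` flags on every declaration; the lakefile turns the
-- linter off tree-wide (weak option), restated here so stand-alone elaboration is warning-free too.
set_option linter.dupNamespace false

noncomputable section

open CategoryTheory groupCohomology
open Literature.AlgebraicGeometry.HodgeTheory

namespace Summit.HodgeConjecture.HodgeConjecture.Theorems

section NCSubconfiguration

variable {G : Type} [Group G]

/-- Generators of a subgroup, viewed inside it, generate it: if `φ : Fin n ≃ s'` enumerates a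
subset `s'` of `G`, the family `i ↦ ⟨φ i, _⟩` generates `Subgroup.closure s'` as a group.
[folklore] -/
theorem localTubeSpan_closure_range_enum_eq_top (s' : Set G) {n : ℕ} (φ : Fin n ≃ ↥s') :
    Subgroup.closure (Set.range fun i : Fin n =>
      (⟨(φ i : G), Subgroup.subset_closure (φ i).2⟩ : Subgroup.closure s')) = ⊤ := by
  have h : (Set.range fun i : Fin n =>
      (⟨(φ i : G), Subgroup.subset_closure (φ i).2⟩ : Subgroup.closure s')) =
      ((↑) : Subgroup.closure s' → G) ⁻¹' s' := by
    ext x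
    simp only [Set.mem_range, Set.mem_preimage]
    constructor
    · rintro ⟨i, rfl⟩
      exact (φ i).2
    · intro hx
      refine ⟨φ.symm ⟨(x : G), hx⟩, Subtype.ext ?_⟩
      rw [Equiv.apply_symm_apply]
  rw [h]
  exact Subgroup.closure_closure_coe_preimage

/-- **Relations carried by an orthogonal sub-configuration** (local Schnell theorem at a point of
the discriminant whose only linear relations among the generating vanishing cycles come from
transversal nodes).  Let `G`, generated by a set `s`, act on the finite-dimensional `ℚ`-space
`V = A` carrying a nondegenerate bilinear form `B` through Picard–Lefschetz transvections
`t(x) = x - B(x, e_t) e_t` (`t ∈ s`).  If a finite sub-configuration `s' ⊆ s` consists of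
non-zero, pairwise `B`-orthogonal cycles `e_t`, and the remaining cycles `e_t`, `t ∈ s ∖ s'`, are
linearly independent modulo `span {e_t : t ∈ s'}` (every linear relation among the `e_t` is
supported on `s'`), then Schnell's third map `H¹(G, A) → ∏_{g ∈ G} A/(g - 1)A` is injective:
the normal-crossing nodal lemma on `⟨s'⟩`, then the sub-configuration reduction.  No named fact
is used. [cite: Schnell2010, §7 Prop. 12] -/
theorem localTubeSpan_injective_evalCoinv_of_ncSubconfiguration (A : Rep.{0} ℚ G)
    [FiniteDimensional ℚ A.V] (B : LinearMap.BilinForm ℚ A.V)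
    (hB : B.Nondegenerate) (s : Set G) (hs : Subgroup.closure s = ⊤) (e : G → A.V)
    (hPL : ∀ t ∈ s, ∀ x : A.V, A.ρ t x = x - B x (e t) • e t)
    (s' : Set G) (hs' : s' ⊆ s) (hs'fin : s'.Finite)
    (horth : ∀ t ∈ s', ∀ t' ∈ s', B (e t) (e t') = 0) (hne : ∀ t ∈ s', e t ≠ 0)
    (hind : LinearIndependent ℚ
      (fun t : ↥(s \ s') => (Submodule.span ℚ (e '' s')).mkQ (e t))) :
    Function.Injective (evalCoinv A) := by
  haveI : Fintype ↥s' := hs'fin.fintype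
  -- enumerate the finite sub-configuration
  set ψ : Fin (Fintype.card ↥s') ≃ ↥s' := (Fintype.equivFin ↥s').symm
  -- its elements, viewed inside the subgroup `⟨s'⟩` they generate
  set t : Fin (Fintype.card ↥s') → Subgroup.closure s' :=
    fun i => ⟨(ψ i : G), Subgroup.subset_closure (ψ i).2⟩
  have ht : Subgroup.closure (Set.range t) = ⊤ := localTubeSpan_closure_range_enum_eq_top s' ψ
  -- the NC nodal lemma on `⟨s'⟩`: commuting transvections along orthogonal non-zero cycles
  have hinj : Function.Injective (evalCoinv (Rep.res (Subgroup.closure s').subtype A)) :=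
    localTubeSpan_injective_evalCoinv_of_orthogonal_transvections
      (Rep.res (Subgroup.closure s').subtype A) B hB t ht (fun i => e (ψ i))
      (fun i => hne _ (ψ i).2)
      (fun i x => by rw [Rep.coe_res_obj_ρ']; exact hPL _ (hs' (ψ i).2) x)
      (fun i j => horth _ (ψ i).2 _ (ψ j).2)
  -- the sub-configuration reduction lifts injectivity from `⟨s'⟩` to `G`
  exact localTubeSpan_injective_evalCoinv_of_subconfiguration A B hB s hs e hPL s' hs' hinj hind

end NCSubconfiguration

end Summit.HodgeConjecture.HodgeConjecture.Theorems

end
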